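import Literature.AlgebraicGeometry.Resolution.TameRootLayers
import Literature.AlgebraicGeometry.Resolution.HenselianRationalityPerfectSplit
import HarnessLib

/-!
# Henselian rationality after a finite tame Galois extension of the constants (Temkin 2013, Thm. 3.2.3, Step 1)

Topic: `Literature/AlgebraicGeometry/Resolution` (valued function fields). M. Temkin,
*Inseparable local uniformization*, J. Algebra 373 (2013) 65–119 = arXiv:0804.1554, proof of
**Thm. 3.2.3, Step 1**, first half (p. 24 of the held arXiv text):

> It follows from Corollary 3.1.10 that `K_m = \widehat{k^{mr}K}` is split over
> `k_m = \widehat{k^{mr}}`, hence `K_m = \overline{k_m(T_m)}` by the above case. … It is a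
> standard fact … that the affinoid domain `C'_m` can be defined already over a finite extension
> `l/k` … `C'_l` is an `l`-split disc and `H(x_l) = \overline{l(T')}` … we can replace `l` with
> its Galois closure (which is contained in `k_m`).

In the henselian rendering of the companion files this reads, and is PROVED here
(`exists_tame_rootLayer_henselianRational`): let `(Ω, V)` be algebraically closed of
characteristic `p`, `C ≤ F ≤ Ω` with `C` perfect, henselian, of rank one, `F|C` a finitely
generated IMMEDIATE function field of transcendence degree `1` (separably generated, `C` being
perfect), and `C` algebraically closed in `F^h` (split case). Then there are a TAME root layer `L = C(roots P)`
(`TameRootLayers.lean`: a finite Galois extension of `C` with trivial ramification group —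
"moderately ramified" —) and `x ∈ F·L`, transcendental over `C`, with `F·L ⊆ L(x)^h`: the
function field becomes henselian rational after the finite tame Galois extension `L` of its
constants. Proof: over the tame hull `T ⊇ C` (`exists_tame_extension`: no tame extensions) the
immediate function field `F·T` is `T`-split (`mem_adjoin_rootSet_of_isAlgebraic`, through the
root layers) and henselian rational by `henselianRational_of_perfect_of_forall_isAlgebraic_mem`
("the above case", [temst] Thm. 6.3.1 = Kuhlmann 2019 Prop. 5.2); the generator and the
finitely many generators of `F` descend to a finite level by
`HenselizationDirectedUnion.lean`. The remaining descent from `L` to `C` (Temkin: [Duc];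
algebraically: Kuhlmann–Vlahu 2014 §14) is `TameDescentTrace.lean` ff., whose input format
(`E(roots P) ⊆ L(x)^h`, `E = F^h`) is `exists_tame_rootLayer_henselianRational_top`.

* `sup_eq_closure_union`, `isAlgebraic_sup_adjoin_singleton` — bookkeeping — PROVED (the base
  change `FGOver T (F ⊔ T)` is `FGOver.sup_right` of `ValuedFunctionFieldsLemmas.lean`);
* `mem_of_mem_henselization_sup_of_isAlgebraic` — `T` is algebraically closed in `(F·T)^h` —
  PROVED;
* `exists_tame_rootLayer_henselianRational` — **Thm. 3.2.3, Step 1 (first half)** — PROVED;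
* `exists_tame_rootLayer_henselianRational_top` — the same in the format of
  `TameDescentTrace.exists_good_trace` / `TameDescent.le_henselization_of_rootLayer` — PROVED.

No definitions, no named facts.

## Sources

* M. Temkin, J. Algebra 373 (2013) = arXiv:0804.1554: Thm. 3.2.3 and its proof (Step 1),
  Cor. 3.1.10 (p. 24 / p. 22 of the held arXiv text). [Temkin2013]
* F.-V. Kuhlmann, Israel J. Math. 234 (2019) = arXiv:1701.05508, Prop. 5.2, through
  `HenselianRationalityPerfectSplit.lean`. [Kuhlmann2019]
* F.-V. Kuhlmann, I. Vlahu, Math. Z. 276 (2014) = arXiv:1304.0200, §14 (the consumer).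
  [KuhlmannVlahu2014]
-/

noncomputable section

open Polynomial IntermediateField IsLocalRing

namespace Literature.AlgebraicGeometry.Resolution

universe u

variable {Ω : Type u} [Field Ω] (V : ValuationSubring Ω)

/-! ### Bookkeeping -/

section Bookkeeping

omit V in
/-- `F ⊔ T = closure (T ∪ F)`. [folklore] -/
theorem sup_eq_closure_union (F T : Subfield Ω) :
    F ⊔ T = Subfield.closure ((T : Set Ω) ∪ (F : Set Ω)) := by
  rw [Subfield.closure_union, Subfield.closure_eq, Subfield.closure_eq, sup_comm]

omit V in
/-- Elements of `F ⊔ T` are algebraic over `T(t₀)` when the elements of `F` are algebraic over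
`C(t₀)`, `C ≤ T`, `t₀ ∈ F`. [folklore] -/
theorem isAlgebraic_sup_adjoin_singleton {C F T : Subfield Ω} (hCT : C ≤ T) {t₀ : Ω}
    (halg : ∀ z ∈ F, IsAlgebraic (IntermediateField.adjoin C ({t₀} : Set Ω)) z) :
    ∀ z ∈ F ⊔ T, IsAlgebraic (IntermediateField.adjoin T ({t₀} : Set Ω)) z := by
  intro z hz
  set K' : Subfield Ω := Subfield.closure ((T : Set Ω) ∪ {t₀}) with hK'
  have hCK' : Subfield.closure ((C : Set Ω) ∪ {t₀}) ≤ K' :=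
    Subfield.closure_mono (Set.union_subset_union_left _ hCT)
  have hF : ∀ w ∈ (F : Set Ω), IsAlgebraic K' w := fun w hw =>
    isAlgebraic_of_subfield_le hCK' ((isAlgebraic_closure_iff C {t₀} w).mpr (halg w hw))
  have hzK : z ∈ Subfield.closure ((K' : Set Ω) ∪ (F : Set Ω)) := by
    have hle : F ⊔ T ≤ Subfield.closure ((K' : Set Ω) ∪ (F : Set Ω)) :=
      sup_le (fun w hw => Subfield.subset_closure (Or.inr hw)) fun w hw =>
        Subfield.subset_closure (Or.inl (Subfield.subset_closure (Or.inl hw)))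
    exact hle hz
  have h1 : IsAlgebraic K' z := isAlgebraic_of_mem_closure hF hzK
  exact (isAlgebraic_closure_iff T {t₀} z).mp h1

end Bookkeeping

/-! ### `T` is algebraically closed in `(F·T)^h` -/

section Split

variable [IsAlgClosed Ω]

/-- **No new constants over the tame hull.** Let `C ≤ F` with `C` perfect and algebraically
closed in `E = F^h`, and let `T ⊇ C` be a union of root layers over `C` in the sense that every
finite subset of `T` lies in some `C(roots P) ⊆ T`. Then every element of `(F ⊔ T)^h`
algebraic over `C` lies in `T`: it lies in `(F·C(roots P))^h ⊆ E(roots P)` for one layer, and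
`E(roots P) ∩ C̃ = C(roots P)` (`mem_adjoin_rootSet_of_isAlgebraic`). [folklore] -/
theorem mem_of_mem_henselization_sup_of_isAlgebraic {C F T : Subfield Ω} [PerfectField C]
    (hCF : C ≤ F) (hCT : C ≤ T)
    (hrel : ∀ a ∈ henselization V F, IsAlgebraic C a → a ∈ C)
    (hfin : ∀ s : Finset Ω, (↑s : Set Ω) ⊆ T → ∃ P : Polynomial C,
      (↑s : Set Ω) ⊆ (IntermediateField.adjoin C (P.rootSet Ω) : IntermediateField C Ω) ∧
      ((IntermediateField.adjoin C (P.rootSet Ω) : IntermediateField C Ω) : Set Ω) ⊆ T)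
    {a : Ω} (ha : a ∈ henselization V (F ⊔ T)) (haC : IsAlgebraic C a) : a ∈ T := by
  classical
  have hH := Kuhlmann2010HenselizationIsHenselian_holds.{u}
  set E : Subfield Ω := henselization V F with hE
  have hCE : C ≤ E := hCF.trans (le_henselization V F)
  have hEh : IsHenselianField E (V.comap (algebraMap E Ω)) := hH Ω V F
  -- `a` lies in the henselization of a finite level `C(s)·F`, `s ⊆ T` finite
  have ha' : a ∈ henselization V (Subfield.closure ((T : Set Ω) ∪ (F : Set Ω))) := by
    rwa [← sup_eq_closure_union]
  obtain ⟨s, hsT, hs⟩ := exists_finset_forall_mem_henselization_closure_levels V hCT (F : Set Ω)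
    {a} (fun z hz => by rw [Finset.mem_singleton] at hz; subst hz; exact ha')
  have has := hs a (Finset.mem_singleton_self a)
  obtain ⟨P, hsP, hPT⟩ := hfin s hsT
  -- `(C(s)·F)^h ≤ E(roots P)`
  set M : Subfield Ω := (IntermediateField.adjoin E (P.rootSet Ω)).toSubfield with hM
  have hMh : IsHenselianField M (V.comap (algebraMap M Ω)) :=
    isHenselianField_toSubfield_adjoin_rootSet_top V hCE P hEh
  have hle : Subfield.closure ((C : Set Ω) ∪ ↑s ∪ (F : Set Ω)) ≤ M := by
    refine Subfield.closure_le.mpr (Set.union_subset (Set.union_subset ?_ ?_) ?_)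
    · exact fun c hc => le_toSubfield_adjoin_rootSet_top P (hCE hc)
    · exact fun z hz => toSubfield_adjoin_rootSet_le hCE P (hsP hz)
    · exact fun z hz => le_toSubfield_adjoin_rootSet_top P (le_henselization V F hz)
  have haM : a ∈ M := henselization_le_of_isHenselianField V _ hle hMh has
  exact hPT (mem_adjoin_rootSet_of_isAlgebraic hCE P hrel haM haC)

end Split

/-! ### Thm. 3.2.3, Step 1 (first half): henselian rationality at a finite tame level -/

section Main

variable [IsAlgClosed Ω]

set_option maxHeartbeats 800000 in
/-- **Temkin 2013, Thm. 3.2.3, Step 1 (first half) — henselian rationality after a finite tame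
Galois extension of the constants.** Let `(Ω, V)` be algebraically closed of characteristic `p`
(residue characteristic `p`), `C ≤ F ≤ Ω` with `C` perfect, henselian and of rank one, `F|C`
finitely generated of transcendence degree `1` (hence separably generated, `C` being perfect)
and IMMEDIATE, and assume that every element of `F^h` algebraic over `C` lies in `C` (`F^h` is
`C`-split, Cor. 3.1.10). Then
there are a non-zero `P ∈ C[X]` whose root layer `L = C(roots P)` (a finite Galois extension
of `C`) has trivial ramification group, and `x ∈ F·L`, transcendental over `C`, with
`F·L ⊆ L(x)^h`. PROVED: tame hull `T` (`exists_tame_extension`), `T`-splitness of `(F·T)^h`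
(`mem_of_mem_henselization_sup_of_isAlgebraic`), immediateness of `(F·T)^h|T`
(`isImmediateOver_of_forall_isAlgebraic_mem`), henselian rationality over `T`
(`henselianRational_of_perfect_of_forall_isAlgebraic_mem`), and descent of the generator and of
the generators of `F` to one tame layer (`HenselizationDirectedUnion.lean`).
[cite: Temkin2013, Thm. 3.2.3 (proof, Step 1)] [cite: Kuhlmann2019, Prop. 5.2] -/
theorem exists_tame_rootLayer_henselianRational (p : ℕ) [hp : Fact p.Prime] [CharP Ω p]
    [CharP (ResidueField V) p] {C F : Subfield Ω} (hCF : C ≤ F)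
    (hperf : ∀ y ∈ C, ∃ b ∈ C, b ^ p = y)
    (hC : IsHenselianField C (V.comap (algebraMap C Ω))) (hr1 : IsRankOneValued V C)
    (hfg : FGOver C F)
    (h1 : ∃ t ∈ F, Transcendental C t ∧
      ∀ z ∈ F, IsAlgebraic (IntermediateField.adjoin C ({t} : Set Ω)) z)
    (himm : IsImmediateOver V C F)
    (hrel : ∀ a ∈ henselization V F, IsAlgebraic C a → a ∈ C) :
    ∃ P : Polynomial C, P ≠ 0 ∧
      ramificationGroupIn V (IntermediateField.adjoin C (P.rootSet Ω)) = ⊥ ∧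
      ∃ x ∈ F ⊔ (IntermediateField.adjoin C (P.rootSet Ω)).toSubfield, Transcendental C x ∧
        F ⊔ (IntermediateField.adjoin C (P.rootSet Ω)).toSubfield ≤ henselization V
          (Subfield.closure
            (((IntermediateField.adjoin C (P.rootSet Ω)).toSubfield : Set Ω) ∪ {x})) := by
  classical
  haveI : PerfectField C := perfectField_of_forall_exists_pow_eq p hperf
  have hH := Kuhlmann2010HenselizationIsHenselian_holds.{u}
  ------------------------------------------------------------------
  -- ### the tame hull `T` and the base change `FT = F·T`
  ------------------------------------------------------------------
  obtain ⟨T, hCT, halgT, hT, hperfT, hdivT, hresT, hr1T, hfin, hlayer⟩ :=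
    exists_tame_extension V p hC hperf hr1
  haveI : PerfectField T := perfectField_of_forall_exists_pow_eq p hperfT
  set FT : Subfield Ω := F ⊔ T with hFT
  have hTFT : T ≤ FT := le_sup_right
  have hFFT : F ≤ FT := le_sup_left
  have halgFT : ∀ z ∈ FT, IsAlgebraic F z := by
    intro z hz
    have hz' : z ∈ Subfield.closure ((F : Set Ω) ∪ (T : Set Ω)) := by
      rw [Subfield.closure_union, Subfield.closure_eq, Subfield.closure_eq]
      exact hz
    exact isAlgebraic_of_mem_closure
      (fun w hw => isAlgebraic_of_subfield_le hCF (halgT w hw)) hz'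
  ------------------------------------------------------------------
  -- ### the hypotheses of henselian rationality over `T`
  ------------------------------------------------------------------
  have hfgT : FGOver T FT := hfg.sup_right hCT
  have hsgT : SeparablyGeneratedOver T FT := separablyGeneratedOver_of_perfectField hfgT
  obtain ⟨t₀, ht₀F, ht₀, halg₀⟩ := h1
  have ht₀T : Transcendental T t₀ := fun h => ht₀ (isAlgebraic_trans_subfield hCT halgT h)
  have h1T : ∃ t ∈ FT, Transcendental T t ∧
      ∀ z ∈ FT, IsAlgebraic (IntermediateField.adjoin T ({t} : Set Ω)) z :=
    ⟨t₀, hFFT ht₀F, ht₀T, isAlgebraic_sup_adjoin_singleton hCT halg₀⟩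
  -- `T` is algebraically closed in `(FT)^h`
  have hfin' : ∀ s : Finset Ω, (↑s : Set Ω) ⊆ T → ∃ P : Polynomial C,
      (↑s : Set Ω) ⊆ (IntermediateField.adjoin C (P.rootSet Ω) : IntermediateField C Ω) ∧
      ((IntermediateField.adjoin C (P.rootSet Ω) : IntermediateField C Ω) : Set Ω) ⊆ T := by
    intro s hs
    obtain ⟨P, hP0, hram, hsP⟩ := hfin s hs
    exact ⟨P, hsP, hlayer P hP0 hram⟩
  have hrelT : ∀ a ∈ henselization V FT, IsAlgebraic T a → a ∈ T := fun a ha haT =>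
    mem_of_mem_henselization_sup_of_isAlgebraic V hCF hCT hrel hfin' ha
      (isAlgebraic_trans_subfield hCT halgT haT)
  -- `(FT | T)` is immediate: `(FT)^h` is henselian, `T`-split, transcendentally immediate
  set ET : Subfield Ω := henselization V FT with hET
  have hEThens : IsHenselianField ET (V.comap (algebraMap ET Ω)) := hH Ω V FT
  have hTET : T ≤ ET := hTFT.trans (le_henselization V FT)
  have halgET : ∀ a ∈ ET, IsAlgebraic F a := fun a ha =>
    isAlgebraic_trans_subfield hFFT halgFT
      (isSeparable_of_mem_henselization V FT ha).isIntegral.isAlgebraic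
  have htors : ∀ a ∈ ET, a ≠ 0 →
      ∃ n : ℕ, n ≠ 0 ∧ ∃ b ∈ T, V.valuation (a ^ n) = V.valuation b := by
    intro a ha ha0
    obtain ⟨n, hn, b, hbF, hb⟩ := exists_valuation_pow_eq_of_isAlgebraic V (halgET a ha) ha0
    have hb0 : b ≠ 0 := by
      rintro rfl
      rw [map_zero, map_pow, pow_eq_zero_iff hn, map_eq_zero] at hb
      exact ha0 hb
    obtain ⟨c, hcC, hbc⟩ := himm.1 b hbF hb0
    exact ⟨n, hn, c, hCT hcC, hb.trans hbc⟩
  have hresalg : ∀ (r : Ω) (hrE : r ∈ ET) (hrV : r ∈ V),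
      IsAlgebraic (resField V T) (residue V ⟨r, hrV⟩) := by
    intro r hrE hrV
    have h1 : IsAlgebraic (resField V F) (residue V ⟨r, hrV⟩) :=
      isAlgebraic_residue_of_isAlgebraic V hrV (halgET r hrE)
    exact isAlgebraic_of_subfield_le (himm.2.trans (resField_mono V hCT)) h1
  have himmET : IsImmediateOver V T ET :=
    isImmediateOver_of_forall_isAlgebraic_mem V p hTET hperfT hEThens hrelT htors hresalg
  have himmT : IsImmediateOver V T FT := himmET.mono_right (le_henselization V FT)
  ------------------------------------------------------------------
  -- ### henselian rationality over `T`
  ------------------------------------------------------------------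
  obtain ⟨x, hxFT, hxT, hHR⟩ := henselianRational_of_perfect_of_forall_isAlgebraic_mem V p T FT
    hT hperfT (isRankOne_of_isRankOneValued V hr1T) hdivT hresT hTFT hfgT hsgT h1T himmT hrelT
  ------------------------------------------------------------------
  -- ### descent to one tame layer
  ------------------------------------------------------------------
  -- the generator `x ∈ C(s₁)·F`
  obtain ⟨s₁, hs₁T, hs₁⟩ := exists_finset_forall_mem_closure_levels hCT (F : Set Ω) {x}
    (fun z hz => by
      rw [Finset.mem_singleton] at hz
      subst hz
      rw [← sup_eq_closure_union]
      exact hxFT)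
  have hx₁ := hs₁ x (Finset.mem_singleton_self x)
  -- the generators `g` of `F` lie in `C(s₂)(x)^h`
  obtain ⟨g, hg⟩ := hfg
  have hgF : ∀ z ∈ g, z ∈ F := fun z hz => by
    rw [← hg]
    exact Subfield.subset_closure (Or.inr hz)
  obtain ⟨s₂, hs₂T, hs₂⟩ := exists_finset_forall_mem_henselization_closure_levels V hCT
    ({x} : Set Ω) g (fun z hz => hHR (hFFT (hgF z hz)))
  -- one tame layer containing `s₁ ∪ s₂`
  obtain ⟨P, hP0, hram, hsP⟩ := hfin (s₁ ∪ s₂) (by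
    rw [Finset.coe_union]
    exact Set.union_subset hs₁T hs₂T)
  set L : Subfield Ω := (IntermediateField.adjoin C (P.rootSet Ω)).toSubfield with hL
  have hCL : C ≤ L := le_toSubfield_adjoin_rootSet P
  have hs₁L : (↑s₁ : Set Ω) ⊆ L := fun z hz => hsP (by
    rw [Finset.coe_union]
    exact Or.inl hz)
  have hs₂L : (↑s₂ : Set Ω) ⊆ L := fun z hz => hsP (by
    rw [Finset.coe_union]
    exact Or.inr hz)
  refine ⟨P, hP0, hram, x, ?_, fun h => hxT (isAlgebraic_of_subfield_le hCT h), ?_⟩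
  · -- `x ∈ F ⊔ L`
    have hle : Subfield.closure ((C : Set Ω) ∪ ↑s₁ ∪ (F : Set Ω)) ≤ F ⊔ L :=
      Subfield.closure_le.mpr (Set.union_subset (Set.union_subset
        (fun c hc => (le_sup_right : L ≤ F ⊔ L) (hCL hc))
        (fun z hz => (le_sup_right : L ≤ F ⊔ L) (hs₁L hz)))
        (fun z hz => (le_sup_left : F ≤ F ⊔ L) hz))
    exact hle hx₁
  · -- `F ⊔ L ≤ L(x)^h`
    have hLH : L ≤ henselization V (Subfield.closure ((L : Set Ω) ∪ {x})) := fun z hz =>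
      le_henselization V _ (Subfield.subset_closure (Or.inl hz))
    refine sup_le ?_ hLH
    rw [← hg]
    refine Subfield.closure_le.mpr (Set.union_subset (fun c hc => hLH (hCL hc)) fun z hz => ?_)
    refine henselization_mono V hH (Subfield.closure_mono ?_) (hs₂ z hz)
    exact Set.union_subset_union_left _
      (Set.union_subset (fun c hc => hCL hc) fun w hw => hs₂L hw)

/-- **The same, in the format consumed by the pull-down** (`TameDescentTrace.exists_good_trace`,
`TameDescent.le_henselization_of_rootLayer`): a non-zero `P` with `G^r(C(roots P)|C) = 1`, and
`x ∈ E(roots P)`, `E = F^h`, transcendental over `C`, lying in `F·C(roots P)`, with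
`E(roots P) ⊆ C(roots P)(x)^h`.
[cite: Temkin2013, Thm. 3.2.3 (proof, Step 1)] -/
theorem exists_tame_rootLayer_henselianRational_top (p : ℕ) [hp : Fact p.Prime] [CharP Ω p]
    [CharP (ResidueField V) p] {C F : Subfield Ω} (hCF : C ≤ F)
    (hperf : ∀ y ∈ C, ∃ b ∈ C, b ^ p = y)
    (hC : IsHenselianField C (V.comap (algebraMap C Ω))) (hr1 : IsRankOneValued V C)
    (hfg : FGOver C F)
    (h1 : ∃ t ∈ F, Transcendental C t ∧
      ∀ z ∈ F, IsAlgebraic (IntermediateField.adjoin C ({t} : Set Ω)) z)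
    (himm : IsImmediateOver V C F)
    (hrel : ∀ a ∈ henselization V F, IsAlgebraic C a → a ∈ C) :
    ∃ P : Polynomial C, P ≠ 0 ∧
      ramificationGroupIn V (IntermediateField.adjoin C (P.rootSet Ω)) = ⊥ ∧
      ∃ x ∈ (IntermediateField.adjoin (henselization V F) (P.rootSet Ω)).toSubfield,
        Transcendental C x ∧
        x ∈ F ⊔ (IntermediateField.adjoin C (P.rootSet Ω)).toSubfield ∧
        ((IntermediateField.adjoin (henselization V F) (P.rootSet Ω) :
            IntermediateField (henselization V F) Ω) : Set Ω) ⊆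
          henselization V (Subfield.closure
            (((IntermediateField.adjoin C (P.rootSet Ω)).toSubfield : Set Ω) ∪ {x})) := by
  obtain ⟨P, hP0, hram, x, hxFL, hxC, hFL⟩ :=
    exists_tame_rootLayer_henselianRational V p hCF hperf hC hr1 hfg h1 himm hrel
  have hH := Kuhlmann2010HenselizationIsHenselian_holds.{u}
  have hCE : C ≤ henselization V F := hCF.trans (le_henselization V F)
  refine ⟨P, hP0, hram, x, ?_, hxC, hxFL, ?_⟩
  · have hle : F ⊔ (IntermediateField.adjoin C (P.rootSet Ω)).toSubfield ≤
        (IntermediateField.adjoin (henselization V F) (P.rootSet Ω)).toSubfield :=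
      sup_le (fun z hz => le_toSubfield_adjoin_rootSet_top P (le_henselization V F hz))
        (toSubfield_adjoin_rootSet_le hCE P)
    exact hle hxFL
  · have hHh := hH Ω V (Subfield.closure
      (((IntermediateField.adjoin C (P.rootSet Ω)).toSubfield : Set Ω) ∪ {x}))
    have hFLH := henselization_le_of_isHenselianField V _ hFL hHh
    have hEH : henselization V F ≤ henselization V (Subfield.closure
        (((IntermediateField.adjoin C (P.rootSet Ω)).toSubfield : Set Ω) ∪ {x})) :=
      (henselization_mono V hH
        (le_sup_left : F ≤ F ⊔ (IntermediateField.adjoin C (P.rootSet Ω)).toSubfield)).trans hFLH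
    have hLH : (IntermediateField.adjoin C (P.rootSet Ω)).toSubfield ≤ henselization V
        (Subfield.closure
          (((IntermediateField.adjoin C (P.rootSet Ω)).toSubfield : Set Ω) ∪ {x})) :=
      ((le_sup_right : (IntermediateField.adjoin C (P.rootSet Ω)).toSubfield ≤
        F ⊔ (IntermediateField.adjoin C (P.rootSet Ω)).toSubfield).trans
          (le_henselization V _)).trans hFLH
    intro z hz
    have hz' : z ∈ Subfield.closure (((henselization V F : Subfield Ω) : Set Ω) ∪ P.rootSet Ω) :=
      (mem_adjoin_subfield_iff (henselization V F) _ z).mp hz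
    exact Subfield.closure_le.mpr (Set.union_subset (fun w hw => hEH hw)
      fun w hw => hLH (IntermediateField.subset_adjoin C _ hw)) hz'

end Main

end Literature.AlgebraicGeometry.Resolution

end
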